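import Summits.RiemannHypothesis.RiemannHypothesis.Theorems.HandoffBumpAutocorr
import Literature.NumberTheory.LFunctions.LandauOscillation
import Literature.NumberTheory.LFunctions.MertensOneSided
import Literature.NumberTheory.LFunctions.WeilMellinBounds
import Mathlib.NumberTheory.LSeries.Dirichlet
import HarnessLib

/-!
# HANDOFF — the smoothed Chebyshev sum of a bump and its Mellin transform (cell rh-explicit, TRACK «HANDOFF», seat theory-2; file B1 of LEMMA L)

HONEST FRAMING. Nothing here bears on the truth of RH; this is bookkeeping for LEMMA L (`HandoffBottomDropProof.lean`): for a bump `ψ`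
(`ContDiffBump 0`, radius `r`) with real autocorrelation `φ_r(w) = ∫ψ(u)ψ(u − w)du` (`= φ = ψ ⋆ ψ̃` of file A1, `HandoffBumpAutocorr.lean`),
the smoothed `n^{−1/2}`-weighted Chebyshev sum `F(x) = Σ_n Λ(n)n^{−1/2}φ_r(log n − log x)` — the prime side of file A's dipole inequality read
at `L = log x` (`re_tsum_eq_F`) — is a locally finite sum (`F_eq_sum`: terms with `n > e^{2r+|log x|}` vanish), measurable (`measurable_F`),
`|F(x)| ≤ 4e^{4r}(∫ψ)x²` for `x ≥ 1` (`abs_F_le`), and for `r < (log 2)/4` and `Re s > 1` its Mellin transform in the tree's Landau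
normalisation is **`∫₁^∞ F(x)x^{−(s+1)}dx = Φ(s)·L(Λ, s + ½)`**, `Φ(s) = φ̂(s + ½) = ∫φ(v)e^{sv}dv` (`mellinIoi_F`; termwise by the substitution
`x = e^u`, the window of the `n`-th term lying inside `(1, ∞)` for `n ≥ 2`, and Tonelli through the exact value of the norm integrals). Also the
power integrals `∫₁^∞ x^{−(s+1)} = 1/s`, `∫₁^∞ √x·x^{−(s+1)} = 1/(s − ½)`, `∫₁^∞ x^{−(s+1)}/√x = 1/(s + ½)`.

References: H. L. Montgomery, R. C. Vaughan, Multiplicative Number Theory I (2007) §15.1 (proof of Thm 15.2) (`MontgomeryVaughan2007`).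
-/

set_option linter.dupNamespace false  -- the mandated namespace repeats `RiemannHypothesis`

noncomputable section

open Set Filter Complex MeasureTheory Topology Literature.NumberTheory.LFunctions
open Literature.NumberTheory.LFunctions.Landau
open Summit.RiemannHypothesis.RiemannHypothesis.Theorems.HandoffBumpAutocorr
open scoped Real ComplexConjugate ArithmeticFunction.vonMangoldt

namespace Summit.RiemannHypothesis.RiemannHypothesis.Theorems.HandoffChebyshevMellin

variable (ψ : ContDiffBump (0 : ℝ))

/-! ## §1  The smoothed Chebyshev sum `F`: real, locally finite, measurable, `O(x²)` -/

/-- The complex tsum of file A is the real sum `F`: `Re Σ_n (Λ(n)/√n)·φ(log n − L) = F(e^L)`. [folklore] -/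
theorem re_tsum_eq_F (L : ℝ) :
    (∑' n : ℕ, ((Λ n : ℝ) : ℂ) / (Real.sqrt n : ℂ) * (weilConv (fun x : ℝ ↦ ((ψ x : ℝ) : ℂ)) (weilReflect fun x : ℝ ↦ ((ψ x : ℝ) :
          ℂ))) (Real.log n - L)).re = (fun x : ℝ ↦ ∑' n : ℕ, (Λ n : ℝ) / Real.sqrt n * (∫ u : ℝ, ψ u * ψ (u - (Real.log n - Real.log
          x)))) (Real.exp L) := by
  have h : ∀ n : ℕ, ((Λ n : ℝ) : ℂ) / (Real.sqrt n : ℂ) * (weilConv (fun x : ℝ ↦ ((ψ x : ℝ) : ℂ)) (weilReflect fun x : ℝ ↦ ((ψ x :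
        ℝ) : ℂ))) (Real.log n - L) =
      (((Λ n : ℝ) / Real.sqrt n * ∫ u : ℝ, ψ u * ψ (u - (Real.log n - Real.log (Real.exp L))) : ℝ) : ℂ) := by
    intro n
    rw [autocorr_eq, Real.log_exp]
    push_cast
    ring
  simp only [h]
  rw [← Complex.ofReal_tsum, Complex.ofReal_re]

/-- `0 ≤ φ_r(w)`. [folklore] -/
theorem autocorr_nonneg (w : ℝ) : 0 ≤ ∫ u : ℝ, ψ u * ψ (u - w) :=
  integral_nonneg fun _ ↦ mul_nonneg ψ.nonneg ψ.nonneg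

/-- `φ_r(w) ≤ ∫ψ` (`ψ ≤ 1`). [folklore] -/
theorem autocorr_le (w : ℝ) : (∫ u : ℝ, ψ u * ψ (u - w)) ≤ ∫ u : ℝ, ψ u :=
  integral_mono_of_nonneg (Eventually.of_forall fun _ ↦ mul_nonneg ψ.nonneg ψ.nonneg) ψ.integrable
    (Eventually.of_forall fun u ↦ by simpa using mul_le_mul_of_nonneg_left (ψ.le_one (x := u - w)) (ψ.nonneg (x := u)))

/-- `φ_r` is measurable (`φ_r = Re φ`, `φ` smooth). [folklore] -/
theorem measurable_autocorr : Measurable fun w : ℝ ↦ ∫ u : ℝ, ψ u * ψ (u - w) := by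
  have h : (fun w : ℝ ↦ ∫ u : ℝ, ψ u * ψ (u - w)) = fun w ↦ ((weilConv (fun x : ℝ ↦ ((ψ x : ℝ) : ℂ)) (weilReflect fun x : ℝ ↦ ((ψ x
        : ℝ) : ℂ))) w).re := by
    funext w; rw [autocorr_eq, Complex.ofReal_re]
  rw [h]
  exact (continuous_re.comp (isWeilTest_autocorr ψ).1.continuous).measurable

/-- The window: the `n`-th term of `F(x)` vanishes once `n > e^{2r + |log x|}`. [folklore] -/
theorem window_eq_zero {x : ℝ} {n : ℕ} (hn : Real.exp (2 * ψ.rOut + |Real.log x|) < n) :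
    (∫ u : ℝ, ψ u * ψ (u - (Real.log n - Real.log x))) = 0 := by
  have h1 : 2 * ψ.rOut + |Real.log x| < Real.log n := by
    have := Real.log_lt_log (Real.exp_pos _) hn
    rwa [Real.log_exp] at this
  have h2 : 2 * ψ.rOut < |Real.log n - Real.log x| := by
    rw [abs_of_pos (by linarith [le_abs_self (Real.log x), ψ.rOut_pos])]
    linarith [le_abs_self (Real.log x)]
  have h3 := autocorr_eq_zero ψ h2
  rw [autocorr_eq] at h3
  exact_mod_cast h3

/-- `F(x)` is a finite sum: over `n ≤ e^{2r + |log x|}`. [folklore] -/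
theorem F_eq_sum (x : ℝ) :
    (fun x : ℝ ↦ ∑' n : ℕ, (Λ n : ℝ) / Real.sqrt n * (∫ u : ℝ, ψ u * ψ (u - (Real.log n - Real.log x)))) x = ∑ n ∈ Finset.range
          (⌊Real.exp (2 * ψ.rOut + |Real.log x|)⌋₊ + 1),
      (Λ n : ℝ) / Real.sqrt n * ∫ u : ℝ, ψ u * ψ (u - (Real.log n - Real.log x)) := by
  refine tsum_eq_sum fun n hn ↦ ?_
  rw [Finset.mem_range, not_lt] at hn
  rw [window_eq_zero ψ (lt_of_lt_of_le (Nat.lt_floor_add_one _) (by exact_mod_cast hn)), mul_zero]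

/-- `F` is measurable (pointwise limit of the measurable partial sums). [folklore] -/
theorem measurable_F : Measurable (fun x : ℝ ↦ ∑' n : ℕ, (Λ n : ℝ) / Real.sqrt n * (∫ u : ℝ, ψ u * ψ (u - (Real.log n - Real.log x)))) := by
  have hterm : ∀ n : ℕ, Measurable fun x : ℝ ↦
      (Λ n : ℝ) / Real.sqrt n * ∫ u : ℝ, ψ u * ψ (u - (Real.log n - Real.log x)) :=
    fun n ↦ measurable_const.mul ((measurable_autocorr ψ).comp (measurable_const.sub Real.measurable_log))
  refine measurable_of_tendsto_metrizable (f := fun N x ↦ ∑ n ∈ Finset.range N,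
      (Λ n : ℝ) / Real.sqrt n * ∫ u : ℝ, ψ u * ψ (u - (Real.log n - Real.log x)))
    (fun N ↦ Finset.measurable_sum _ fun n _ ↦ hterm n) ?_
  rw [tendsto_pi_nhds]
  intro x
  refine HasSum.tendsto_sum_nat ?_
  exact (summable_of_ne_finset_zero (s := Finset.range (⌊Real.exp (2 * ψ.rOut + |Real.log x|)⌋₊ + 1))
    fun n hn ↦ by
      rw [Finset.mem_range, not_lt] at hn
      rw [window_eq_zero ψ (lt_of_lt_of_le (Nat.lt_floor_add_one _) (by exact_mod_cast hn)), mul_zero]).hasSum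

/-- The crude bound `|F(x)| ≤ 4e^{4r}(∫ψ)·x²` for `x ≥ 1` (`Λ(n) ≤ n`, `φ_r ≤ ∫ψ`, at most `e^{2r}x + 1` terms). [folklore] -/
theorem abs_F_le {x : ℝ} (hx : 1 ≤ x) : |(fun x : ℝ ↦ ∑' n : ℕ, (Λ n : ℝ) / Real.sqrt n * (∫ u : ℝ, ψ u * ψ (u - (Real.log n -
      Real.log x)))) x| ≤ 4 * Real.exp (4 * ψ.rOut) * (∫ u, ψ u) * x ^ 2 := by
  have hx0 : 0 < x := by linarith
  set N : ℕ := ⌊Real.exp (2 * ψ.rOut + |Real.log x|)⌋₊ + 1 with hN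
  have hNx : (N : ℝ) ≤ 2 * Real.exp (2 * ψ.rOut) * x := by
    have h1 : Real.exp (2 * ψ.rOut + |Real.log x|) = Real.exp (2 * ψ.rOut) * x := by
      rw [abs_of_nonneg (Real.log_nonneg hx), Real.exp_add, Real.exp_log hx0]
    have h2 : (⌊Real.exp (2 * ψ.rOut + |Real.log x|)⌋₊ : ℝ) ≤ Real.exp (2 * ψ.rOut) * x :=
      (Nat.floor_le (Real.exp_pos _).le).trans h1.le
    have h3 : 1 ≤ Real.exp (2 * ψ.rOut) * x := by
      nlinarith [Real.one_le_exp (by linarith [ψ.rOut_pos] : 0 ≤ 2 * ψ.rOut)]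
    rw [hN]; push_cast; linarith
  have hB0 : 0 ≤ ∫ u, ψ u := integral_nonneg fun _ ↦ ψ.nonneg
  have hterm : ∀ n ∈ Finset.range N,
      |(Λ n : ℝ) / Real.sqrt n * ∫ u : ℝ, ψ u * ψ (u - (Real.log n - Real.log x))| ≤ N * ∫ u, ψ u := by
    intro n hn
    rw [Finset.mem_range] at hn
    rw [abs_mul, abs_of_nonneg (autocorr_nonneg ψ _),
      abs_of_nonneg (div_nonneg ArithmeticFunction.vonMangoldt_nonneg (Real.sqrt_nonneg _))]
    have h1 : (Λ n : ℝ) / Real.sqrt n ≤ n := by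
      rcases Nat.eq_zero_or_pos n with rfl | hn1
      · simp
      · calc (Λ n : ℝ) / Real.sqrt n ≤ Λ n :=
              div_le_self ArithmeticFunction.vonMangoldt_nonneg (Real.one_le_sqrt.2 (by exact_mod_cast hn1))
          _ ≤ Real.log n := ArithmeticFunction.vonMangoldt_le_log
          _ ≤ n - 1 := Real.log_le_sub_one_of_pos (by exact_mod_cast hn1)
          _ ≤ n := by linarith
    have h2 : (n : ℝ) ≤ N := by exact_mod_cast hn.le
    exact mul_le_mul (h1.trans h2) (autocorr_le ψ _) (autocorr_nonneg ψ _) (Nat.cast_nonneg N)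
  rw [F_eq_sum]
  calc |∑ n ∈ Finset.range N, (Λ n : ℝ) / Real.sqrt n * ∫ u : ℝ, ψ u * ψ (u - (Real.log n - Real.log x))|
      ≤ ∑ n ∈ Finset.range N, |(Λ n : ℝ) / Real.sqrt n * ∫ u : ℝ, ψ u * ψ (u - (Real.log n - Real.log x))| :=
        Finset.abs_sum_le_sum_abs _ _
    _ ≤ ∑ n ∈ Finset.range N, (N : ℝ) * ∫ u, ψ u := Finset.sum_le_sum hterm
    _ = N * (N * ∫ u, ψ u) := by rw [Finset.sum_const, Finset.card_range, nsmul_eq_mul]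
    _ ≤ (2 * Real.exp (2 * ψ.rOut) * x) * ((2 * Real.exp (2 * ψ.rOut) * x) * ∫ u, ψ u) := by gcongr
    _ = 4 * Real.exp (4 * ψ.rOut) * (∫ u, ψ u) * x ^ 2 := by
        rw [show (4 : ℝ) * ψ.rOut = 2 * ψ.rOut + 2 * ψ.rOut by ring, Real.exp_add]; ring

/-! ## §2  Mellin transforms on `Re s > σ`: the power terms, the windowed sum, the comparison function -/

/-- `∫₁^∞ x^{−(s+1)} dx = 1/s` (`Re s > 0`). [folklore] -/
theorem integral_Ioi_cpow_eq {s : ℂ} (hs : 0 < s.re) : ∫ x in Ioi (1 : ℝ), (x : ℂ) ^ (-(s + 1)) = 1 / s := by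
  have hs0 : s ≠ 0 := by intro h; rw [h] at hs; simp at hs
  rw [integral_Ioi_cpow_of_lt (by simp; linarith) one_pos, Complex.ofReal_one, Complex.one_cpow]
  have : -(s + 1) + 1 = -s := by ring
  rw [this]
  field_simp

/-- `√x · x^{−(s+1)} = x^{½−(s+1)}` (`x > 0`). [folklore] -/
theorem sqrt_mul_cpow {x : ℝ} (hx : 0 < x) (s : ℂ) :
    ((Real.sqrt x : ℝ) : ℂ) * (x : ℂ) ^ (-(s + 1)) = (x : ℂ) ^ ((1 / 2 : ℂ) - (s + 1)) := by
  rw [Real.sqrt_eq_rpow, Complex.ofReal_cpow hx.le, sub_eq_add_neg, Complex.cpow_add _ _ (by exact_mod_cast hx.ne')]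
  norm_num

/-- `(√x)⁻¹ · x^{−(s+1)} = x^{−½−(s+1)}` (`x > 0`). [folklore] -/
theorem inv_sqrt_mul_cpow {x : ℝ} (hx : 0 < x) (s : ℂ) :
    (((Real.sqrt x)⁻¹ : ℝ) : ℂ) * (x : ℂ) ^ (-(s + 1)) = (x : ℂ) ^ (-(1 / 2 : ℂ) - (s + 1)) := by
  rw [Real.sqrt_eq_rpow, ← Real.rpow_neg hx.le, Complex.ofReal_cpow hx.le, sub_eq_add_neg,
    Complex.cpow_add _ _ (by exact_mod_cast hx.ne')]
  norm_num

/-- `√x · x^{−(s+1)}` is integrable on `(1, ∞)` for `Re s > ½`. [folklore] -/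
theorem integrableOn_sqrt_mul_cpow {s : ℂ} (hs : 1 / 2 < s.re) :
    IntegrableOn (fun x : ℝ ↦ ((Real.sqrt x : ℝ) : ℂ) * (x : ℂ) ^ (-(s + 1))) (Ioi 1) :=
  (integrableOn_Ioi_cpow_of_lt (show ((1 / 2 : ℂ) - (s + 1)).re < -1 by simp; linarith) one_pos).congr_fun
    (fun _ hx ↦ (sqrt_mul_cpow (lt_trans one_pos hx) s).symm) measurableSet_Ioi

/-- `(√x)⁻¹ · x^{−(s+1)}` is integrable on `(1, ∞)` for `Re s > 0`. [folklore] -/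
theorem integrableOn_inv_sqrt_mul_cpow {s : ℂ} (hs : 0 < s.re) :
    IntegrableOn (fun x : ℝ ↦ (((Real.sqrt x)⁻¹ : ℝ) : ℂ) * (x : ℂ) ^ (-(s + 1))) (Ioi 1) :=
  (integrableOn_Ioi_cpow_of_lt (show (-(1 / 2 : ℂ) - (s + 1)).re < -1 by simp; linarith) one_pos).congr_fun
    (fun _ hx ↦ (inv_sqrt_mul_cpow (lt_trans one_pos hx) s).symm) measurableSet_Ioi

/-- `∫₁^∞ √x · x^{−(s+1)} dx = 1/(s − ½)` (`Re s > ½`). [folklore] -/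
theorem integral_Ioi_sqrt_mul_cpow {s : ℂ} (hs : 1 / 2 < s.re) :
    ∫ x in Ioi (1 : ℝ), ((Real.sqrt x : ℝ) : ℂ) * (x : ℂ) ^ (-(s + 1)) = 1 / (s - 1 / 2) := by
  have hs0 : s - 1 / 2 ≠ 0 := by
    intro h; have := congrArg Complex.re h; simp at this; linarith
  rw [setIntegral_congr_fun measurableSet_Ioi (fun x hx ↦ sqrt_mul_cpow (lt_trans one_pos hx) s),
    integral_Ioi_cpow_of_lt (by simp; linarith) one_pos, Complex.ofReal_one, Complex.one_cpow]
  have : (1 / 2 : ℂ) - (s + 1) + 1 = -(s - 1 / 2) := by ring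
  rw [this]
  field_simp

/-- `∫₁^∞ (√x)⁻¹ · x^{−(s+1)} dx = 1/(s + ½)` (`Re s > 0`). [folklore] -/
theorem integral_Ioi_inv_sqrt_mul_cpow {s : ℂ} (hs : 0 < s.re) :
    ∫ x in Ioi (1 : ℝ), (((Real.sqrt x)⁻¹ : ℝ) : ℂ) * (x : ℂ) ^ (-(s + 1)) = 1 / (s + 1 / 2) := by
  have hs0 : s + 1 / 2 ≠ 0 := by
    intro h; have := congrArg Complex.re h; simp at this; linarith
  rw [setIntegral_congr_fun measurableSet_Ioi (fun x hx ↦ inv_sqrt_mul_cpow (lt_trans one_pos hx) s),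
    integral_Ioi_cpow_of_lt (by simp; linarith) one_pos, Complex.ofReal_one, Complex.one_cpow]
  have : -(1 / 2 : ℂ) - (s + 1) + 1 = -(s + 1 / 2) := by ring
  rw [this]
  field_simp

/-- **The window integral** (substitution `x = e^u`, then `v = log n − u`): for `n ≥ 2` (so that the window lies inside `(1, ∞)`,
as `2r < log 2 ≤ log n`) and every `s`, `∫₁^∞ φ_r(log n − log x) x^{−(s+1)} dx = n^{−s} Φ(s)`. [cite: MontgomeryVaughan2007, §15.1 (proof of Thm 15.2)] -/
theorem integral_window_mul_cpow (hr : ψ.rOut < Real.log 2 / 4) {n : ℕ} (hn : 2 ≤ n) (s : ℂ) :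
    ∫ x in Ioi (1 : ℝ), (((∫ u : ℝ, ψ u * ψ (u - (Real.log n - Real.log x))) : ℝ) : ℂ) * (x : ℂ) ^ (-(s + 1)) =
      (n : ℂ) ^ (-s) * (fun s : ℂ ↦ weilMellin (weilConv (fun x : ℝ ↦ ((ψ x : ℝ) : ℂ)) (weilReflect fun x : ℝ ↦ ((ψ x : ℝ) : ℂ))) (s + 1 / 2)) s := by
  have hlogn : 2 * ψ.rOut < Real.log n := by
    have h2 : Real.log 2 ≤ Real.log n := Real.log_le_log two_pos (by exact_mod_cast hn)
    linarith [Real.log_two_gt_d9]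
  have himg : Real.exp '' Ioi (0 : ℝ) = Ioi 1 := by
    ext x
    constructor
    · rintro ⟨u, hu, rfl⟩
      simpa using hu
    · intro hx
      exact ⟨Real.log x, Real.log_pos hx, Real.exp_log (lt_trans one_pos hx)⟩
  have hderiv : ∀ u ∈ Ioi (0 : ℝ), HasDerivWithinAt Real.exp (Real.exp u) (Ioi 0) u :=
    fun u _ ↦ (Real.hasDerivAt_exp u).hasDerivWithinAt
  rw [← himg, integral_image_eq_integral_abs_deriv_smul measurableSet_Ioi hderiv Real.exp_injective.injOn]
  have h1 : EqOn (fun u : ℝ ↦ |Real.exp u| • ((((∫ y : ℝ, ψ y * ψ (y - (Real.log n - Real.log (Real.exp u)))) : ℝ) : ℂ) *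
      ((Real.exp u : ℝ) : ℂ) ^ (-(s + 1))))
      (fun u : ℝ ↦ (((∫ y : ℝ, ψ y * ψ (y - (Real.log n - u))) : ℝ) : ℂ) * cexp (-(s * u))) (Ioi 0) := by
    intro u _
    simp only
    rw [Real.log_exp, abs_of_pos (Real.exp_pos u), Complex.real_smul, ofReal_exp_cpow, Complex.ofReal_exp, ← mul_assoc,
      mul_comm (cexp _), mul_assoc, ← Complex.exp_add]
    congr 2
    ring
  rw [setIntegral_congr_fun measurableSet_Ioi h1, setIntegral_eq_integral_of_forall_compl_eq_zero fun u hu ↦ ?_]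
  · have h2 : (fun u : ℝ ↦ (((∫ y : ℝ, ψ y * ψ (y - (Real.log n - u))) : ℝ) : ℂ) * cexp (-(s * u))) =
        fun u ↦ (fun v : ℝ ↦ (weilConv (fun x : ℝ ↦ ((ψ x : ℝ) : ℂ)) (weilReflect fun x : ℝ ↦ ((ψ x : ℝ) : ℂ))) v * cexp ((s + 1 / 2
              - 1 / 2) * v) * cexp (-(s * Real.log n))) (Real.log n - u) := by
      funext u
      simp only
      rw [autocorr_eq, mul_assoc, ← Complex.exp_add]
      congr 2
      push_cast
      ring
    have h3 : (n : ℂ) ^ (-s) = cexp (-(s * Real.log n)) := by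
      rw [Complex.cpow_def_of_ne_zero (by exact_mod_cast (by omega : n ≠ 0)), ← Complex.natCast_log]
      congr 1
      ring
    rw [h2, integral_sub_left_eq_self (fun v : ℝ ↦ (weilConv (fun x : ℝ ↦ ((ψ x : ℝ) : ℂ)) (weilReflect fun x : ℝ ↦ ((ψ x : ℝ) :
          ℂ))) v * cexp ((s + 1 / 2 - 1 / 2) * v) *
      cexp (-(s * Real.log n))) volume (Real.log n), integral_mul_const, h3, mul_comm]
    rfl
  · have hu' : u ≤ 0 := not_lt.1 hu
    have h4 : 2 * ψ.rOut < |Real.log n - u| := by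
      rw [abs_of_pos (by linarith [ψ.rOut_pos])]; linarith
    rw [← autocorr_eq, autocorr_eq_zero ψ h4, zero_mul]

/-- The Dirichlet coefficients: `(Λ(n)/√n)·n^{−s}` is the `n`-th term of `L(Λ, s + ½)`. [folklore] -/
theorem coeff_mul_cpow (s : ℂ) (n : ℕ) :
    (((Λ n : ℝ) / Real.sqrt n : ℝ) : ℂ) * (n : ℂ) ^ (-s) = LSeries.term (fun n ↦ (Λ n : ℂ)) (s + 1 / 2) n := by
  rcases Nat.eq_zero_or_pos n with rfl | hn
  · simp
  · have hn' : (n : ℂ) ≠ 0 := by exact_mod_cast hn.ne'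
    have hsq : ((Real.sqrt n : ℝ) : ℂ) = (n : ℂ) ^ (1 / 2 : ℂ) := by
      rw [Real.sqrt_eq_rpow, Complex.ofReal_cpow (Nat.cast_nonneg n)]
      norm_num
    have h1 : (n : ℂ) ^ s ≠ 0 := fun h ↦ hn' ((Complex.cpow_eq_zero_iff _ _).1 h).1
    have h2 : (n : ℂ) ^ (1 / 2 : ℂ) ≠ 0 := fun h ↦ hn' ((Complex.cpow_eq_zero_iff _ _).1 h).1
    rw [LSeries.term_of_ne_zero hn.ne', Complex.cpow_add _ _ hn', Complex.cpow_neg]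
    push_cast
    rw [hsq]
    field_simp

/-- The `n`-th term of the Mellin integral of `F`: `∫₁^∞ (Λ(n)/√n)φ_r(log n − log x)x^{−(s+1)}dx = Φ(s)·Λ(n)n^{−(s+½)}` (all `n`, all `s`;
`Λ(0) = Λ(1) = 0`). [folklore] -/
theorem integral_term (hr : ψ.rOut < Real.log 2 / 4) (s : ℂ) (n : ℕ) :
    ∫ x in Ioi (1 : ℝ), (((Λ n : ℝ) / Real.sqrt n : ℝ) : ℂ) *
      ((((∫ u : ℝ, ψ u * ψ (u - (Real.log n - Real.log x))) : ℝ) : ℂ) * (x : ℂ) ^ (-(s + 1))) =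
      (fun s : ℂ ↦ weilMellin (weilConv (fun x : ℝ ↦ ((ψ x : ℝ) : ℂ)) (weilReflect fun x : ℝ ↦ ((ψ x : ℝ) : ℂ))) (s + 1 / 2)) s *
            LSeries.term (fun n ↦ (Λ n : ℂ)) (s + 1 / 2) n := by
  rw [integral_const_mul]
  rcases lt_or_ge n 2 with hn | hn
  · have h0 : (Λ n : ℝ) = 0 := by interval_cases n <;> simp
    simp [h0, LSeries.term]
  · rw [integral_window_mul_cpow ψ hr hn s, ← mul_assoc, coeff_mul_cpow]
    ring

/-- The terms are integrable on `(1, ∞)` for `Re s > 0` (`0 ≤ φ_r ≤ ∫ψ`). [folklore] -/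
theorem integrable_term (n : ℕ) {s : ℂ} (hs : 0 < s.re) :
    Integrable (fun x : ℝ ↦ (((Λ n : ℝ) / Real.sqrt n : ℝ) : ℂ) *
      ((((∫ u : ℝ, ψ u * ψ (u - (Real.log n - Real.log x))) : ℝ) : ℂ) * (x : ℂ) ^ (-(s + 1))))
      (volume.restrict (Ioi 1)) := by
  refine Integrable.mono'
    (((integrableOn_Ioi_rpow_of_lt (show -(s.re + 1) < -1 by linarith) one_pos).const_mul
      ((Λ n : ℝ) / Real.sqrt n * ∫ u, ψ u))) ?_ ?_
  · exact (measurable_const.mul ((Complex.measurable_ofReal.comp ((measurable_autocorr ψ).comp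
      (measurable_const.sub Real.measurable_log))).mul (Complex.measurable_ofReal.pow_const _))).aestronglyMeasurable
  · rw [ae_restrict_iff' measurableSet_Ioi]
    refine Eventually.of_forall fun x (hx : 1 < x) ↦ ?_
    have hx0 : 0 < x := by linarith
    rw [norm_mul, norm_mul, Complex.norm_real, Complex.norm_real, Complex.norm_cpow_eq_rpow_re_of_pos hx0,
      Real.norm_of_nonneg (div_nonneg ArithmeticFunction.vonMangoldt_nonneg (Real.sqrt_nonneg _)),
      Real.norm_of_nonneg (autocorr_nonneg ψ _), show (-(s + 1)).re = -(s.re + 1) by simp]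
    have h := autocorr_le ψ (Real.log n - Real.log x)
    have h0 : 0 ≤ (Λ n : ℝ) / Real.sqrt n := div_nonneg ArithmeticFunction.vonMangoldt_nonneg (Real.sqrt_nonneg _)
    have h1 : 0 ≤ x ^ (-(s.re + 1)) := Real.rpow_nonneg hx0.le _
    calc (Λ n : ℝ) / Real.sqrt n * ((∫ u : ℝ, ψ u * ψ (u - (Real.log n - Real.log x))) * x ^ (-(s.re + 1)))
        = (∫ u : ℝ, ψ u * ψ (u - (Real.log n - Real.log x))) * ((Λ n : ℝ) / Real.sqrt n * x ^ (-(s.re + 1))) := by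
          ring
      _ ≤ (∫ u, ψ u) * ((Λ n : ℝ) / Real.sqrt n * x ^ (-(s.re + 1))) :=
          mul_le_mul_of_nonneg_right h (mul_nonneg h0 h1)
      _ = (Λ n : ℝ) / Real.sqrt n * (∫ u, ψ u) * x ^ (-(s.re + 1)) := by ring

/-- **The Mellin transform of the smoothed Chebyshev sum** (termwise integration, `Re s > 1`):
`∫₁^∞ F(x) x^{−(s+1)} dx = Φ(s) · L(Λ, s + ½)`. [cite: MontgomeryVaughan2007, §15.1 (proof of Thm 15.2: Mellin transform of the smoothed sum)] -/
theorem mellinIoi_F (hr : ψ.rOut < Real.log 2 / 4) {s : ℂ} (hs : 1 < s.re) :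
    mellinIoi (fun x : ℝ ↦ ∑' n : ℕ, (Λ n : ℝ) / Real.sqrt n * (∫ u : ℝ, ψ u * ψ (u - (Real.log n - Real.log x)))) s = (fun s : ℂ ↦
          weilMellin (weilConv (fun x : ℝ ↦ ((ψ x : ℝ) : ℂ)) (weilReflect fun x : ℝ ↦ ((ψ x : ℝ) : ℂ))) (s + 1 / 2)) s * LSeries
          (fun n ↦ (Λ n : ℂ)) (s + 1 / 2) := by
  set f : ℕ → ℝ → ℂ := fun n x ↦ (((Λ n : ℝ) / Real.sqrt n : ℝ) : ℂ) *
      ((((∫ u : ℝ, ψ u * ψ (u - (Real.log n - Real.log x))) : ℝ) : ℂ) * (x : ℂ) ^ (-(s + 1))) with hf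
  have hFx : ∀ x : ℝ, (((fun x : ℝ ↦ ∑' n : ℕ, (Λ n : ℝ) / Real.sqrt n * (∫ u : ℝ, ψ u * ψ (u - (Real.log n - Real.log x)))) x : ℝ)
        : ℂ) * (x : ℂ) ^ (-(s + 1)) = ∑' n, f n x := by
    intro x
    simp only [hf]
    rw [Complex.ofReal_tsum, ← tsum_mul_right]
    congr 1 with n
    push_cast
    ring
  have hint : ∀ n, Integrable (f n) (volume.restrict (Ioi 1)) := fun n ↦ integrable_term ψ n (by linarith)
  have hnorm : ∀ n, ∫ x in Ioi (1 : ℝ), ‖f n x‖ =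
      ((fun s : ℂ ↦ weilMellin (weilConv (fun x : ℝ ↦ ((ψ x : ℝ) : ℂ)) (weilReflect fun x : ℝ ↦ ((ψ x : ℝ) : ℂ))) (s + 1 / 2)) (s.re
            : ℂ) * LSeries.term (fun n ↦ (Λ n : ℂ)) ((s.re : ℂ) + 1 / 2) n).re := by
    intro n
    rw [← integral_term ψ hr (s.re : ℂ) n, ← RCLike.re_to_complex,
      ← integral_re (integrable_term ψ n (by simp; linarith))]
    refine setIntegral_congr_fun measurableSet_Ioi fun x hx ↦ ?_
    have hx0 : (0 : ℝ) < x := lt_trans one_pos hx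
    simp only [hf, RCLike.re_to_complex]
    rw [show (-((s.re : ℂ) + 1)) = ((-(s.re + 1) : ℝ) : ℂ) by push_cast; ring, ← Complex.ofReal_cpow hx0.le,
      norm_mul, norm_mul, Complex.norm_real, Complex.norm_real, Complex.norm_cpow_eq_rpow_re_of_pos hx0,
      Real.norm_of_nonneg (div_nonneg ArithmeticFunction.vonMangoldt_nonneg (Real.sqrt_nonneg _)),
      Real.norm_of_nonneg (autocorr_nonneg ψ _), show (-(s + 1)).re = -(s.re + 1) by simp,
      ← Complex.ofReal_mul, ← Complex.ofReal_mul, Complex.ofReal_re]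
  have hsum : Summable fun n ↦ ∫ x in Ioi (1 : ℝ), ‖f n x‖ := by
    simp_rw [hnorm]
    have h1 := ArithmeticFunction.LSeriesSummable_vonMangoldt (s := (s.re : ℂ) + 1 / 2) (by simp; linarith)
    simpa using Complex.reCLM.summable (h1.mul_left ((fun s : ℂ ↦ weilMellin (weilConv (fun x : ℝ ↦ ((ψ x : ℝ) : ℂ)) (weilReflect
          fun x : ℝ ↦ ((ψ x : ℝ) : ℂ))) (s + 1 / 2)) (s.re : ℂ)))
  have e1 : mellinIoi (fun x : ℝ ↦ ∑' n : ℕ, (Λ n : ℝ) / Real.sqrt n * (∫ u : ℝ, ψ u * ψ (u - (Real.log n - Real.log x)))) s = ∫ x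
        in Ioi (1 : ℝ), ∑' n, f n x := by
    unfold mellinIoi
    exact setIntegral_congr_fun measurableSet_Ioi fun x _ ↦ hFx x
  have e2 : ∀ n, ∫ x in Ioi (1 : ℝ), f n x = (fun s : ℂ ↦ weilMellin (weilConv (fun x : ℝ ↦ ((ψ x : ℝ) : ℂ)) (weilReflect fun x : ℝ
        ↦ ((ψ x : ℝ) : ℂ))) (s + 1 / 2)) s * LSeries.term (fun n ↦ (Λ n : ℂ)) (s + 1 / 2) n :=
    fun n ↦ by simp only [hf]; exact integral_term ψ hr s n
  rw [e1, ← integral_tsum_of_summable_integral_norm hint hsum]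
  simp_rw [e2]
  rw [tsum_mul_left, LSeries]

end Summit.RiemannHypothesis.RiemannHypothesis.Theorems.HandoffChebyshevMellin

end
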